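import Literature.IUT.HodgeArakelov.StableCurveAgreementInertiaZHat
import Literature.IUT.HodgeArakelov.LabelClassesOfCuspsRmk231ZHat
import Literature.IUT.HodgeArakelov.PlusMinusTowerPiVNormal
import Literature.IUT.HodgeArakelov.PlusMinusTowerPiVIndex
import Literature.AnabelianGeometry.EtaleTheta.Discharge.Sec2Prop24ModelCharacteristic
import HarnessLib

/-!
# [IUTchII] Rmk 2.3.1 «`I ∩ Π_v = I^l`» AT THE GENUINE TOWER: the first claim of the remark as a THEOREM for the cusp datum of record,
# with the total-ramification input discharged from the [EtTh] cusp laws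

S. Mochizuki, *Inter-universal Teichmüller Theory II*, kurims manuscript (Dec. 2020), §2, Remark 2.3.1 p. 69 l. 27–32: «In the situation of
(iii), suppose that the inclusion `Π_⊆ ⊆ Π_⊇` is strict.  Then one verifies immediately that if `I ⊆ Π_⊇` is a cuspidal inertia group of `Π_⊇`, then
the cuspidal inertia group `I ∩ Π_⊆ ⊆ Π_⊆` of `Π_⊆` satisfies `I ∩ Π_⊆ = I^l`»; Rmk 2.1.1 (i) p. 65 («the degree `l` covering … is totally ramified at
the cusps») and Def 2.3 (iii) p. 68 («the inclusion `Π_⊆ ⊆ Π_⊇` corresponds to a totally ramified covering of curves») ([IUTchII] Rmk 2.3.1, kurims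
p.69) [cite: Mochizuki2012, II Rmk 2.3.1 p.69, Rmk 2.1.1 (i) p.65]; [EtTh] Def 2.1 p. 35 («`D_x → Π^Θ_X` … maps the inertia group `I_x ⊆ D_x`
isomorphically onto `Δ_Θ`»), §1 p. 13 (decomposition groups of cusps lie in `Π^tp_Y`), Prop 2.12 (i) p. 45 (`Ker(Δ^Θ_* ↠ Δ^ell_*) = l·Δ_Θ`)
[cite: MochizukiEtTh2009, Def 2.1 p.35].  abc-iut cell, node **IUTchII:Rmk2.3.1** (zone [IUTchII] §2; seat abc-iut-L6-t19 gen 6).  PROOF-ONLY.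

THE POINT.  abc-iut-L6-t19 gen 5 proved the first claim of Rmk 2.3.1 from the printed inputs stated INLINE (`rmk231_powers_of_inputs` p417290,
`rmk231_powers_of_zHat` p418082): `Π_⊆ ⊴ Π_⊇` of prime index `l`, `I ≅ Ẑ(1)`, and TOTAL RAMIFICATION «no cuspidal inertia group of `Π_⊇` lies
in `Π_⊆`».  For the pair `(Π_v, Π^±_v)` of a tower over the print-level model `BadPlaceSetting.ofUnderline` and the cusp datum `Cu` of an agreement
`A : StableCurveAgreement W Cu Du` with abc-iut-L5's [IUTchI] §2 datum `Du` of `X̲_v` (abc-iut-w5-d132's p434636 at the genuine tower of record),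
the first two inputs are KERNEL FACTS (`piV_subgroupOf_piPM_normal_ofUnderline` p429966, `index_piV_subgroupOf_piPM_ofUnderline_eq_l` p429377,
`StableCurveAgreement.nonempty_equiv_zHat_of_isCuspidalInertia_piPM` p443151), and this file DISCHARGES THE THIRD from ONE [EtTh] cusp law of the
base curve `X_v` (type `(1,1)`), carried as the NAMED clause (C3) `toTheta(I_x) = Δ_Θ` of abc-iut-L2-t7's predicate bundle
`ThetaSetting.CuspLaws.map_toTheta_inertia` ([EtTh] Def 2.1 p. 35), plus the non-degeneracy `l·Δ_Θ ≠ Δ_Θ` (from abc-iut-L2-t8's input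
`CyclotomeMod 1 l`, `index_lDeltaTheta_of_cyclotomeMod`).  «`I_x ⊆ Π^tp_Y`» is NOT assumed: it is PROVED here from the interface (`I_x ≃ₜ* Ẑ` is compact
and compact subgroups die in `Z`, abc-iut-L6-d6's `ThetaSetting.le_GtpY_of_isCompact`).  The engine is abc-iut-L2-t8's FIELD
`DoubleUnderline.map_toTheta_Huu : toTheta(Π^tp_{X̲̲_v}) ∩ Δ_Θ = l·Δ_Θ` — «`X̲̲_v → X̲_v` is totally ramified at the cusps».

* `TemperedCurve.inertia_le_GtpY` — `I_x ⊆ Π^tp_Y` for every cusp `x` of the base curve (compactness + discreteness of `Z`);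
* **`PlusMinusTower.StableCurveAgreement.not_le_piV_of_isCuspidalInertia_piPM`** — TOTAL RAMIFICATION for the datum: for ANY tower `W` over a
  Prop 2.1 output `T` of `ofUnderline`, ANY `Cu`, `A` (clause `A.eHat ∘ emb = toHat ∘ plainIso`): a `Π^±_v`-cuspidal inertia group is NOT contained in
  `Π_v` (granted (C3) and `l·Δ_Θ ≠ Δ_Θ`).  [Sibling, keyed to abc-iut-w5-d132's CONTAINMENT datum (p430433) instead: abc-iut-w4-d005's
  `PlusMinusTower.not_cuspFamily_le_piV_ofCoverModel`.]
* **`PlusMinusTower.StableCurveAgreement.rmk231_powers_genuine`** — `Rmk231_powers Cu Π_v Π^±_v` (abc-iut-L6-t1's named Prop, p407174: «`I ∩ Π_v =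
  I^l`» for every `Π^±_v`-cuspidal `I`) for ANY such tower with `Π̂^cor_v` Hausdorff and `emb` continuous; **`rmk231_powers_ofPiCHat`** — the
  instance at the tower of record `ofPiCHat` (continuity of `emb` from p431233, Hausdorff from the profinite completion `Π_C`), packaged with the
  agreement of record: `∃ Cu A, (p434636 clauses) ∧ Rmk231_powers Cu Π_v Π^±_v`.

HONEST LABEL: the [EtTh] clause (C3) and `CyclotomeMod 1 l` are NAMED L2 parameters (origin data of the once-punctured curve; (C3) is kernel-
inhabited at abc-iut-L2's commutator-axis model), the tower's own inputs L02 `hZ`, `hN` and the special-fibre DATA of `X̲_v` stay binders; the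
`Ẑ`-shape is abc-iut-L3's interface field.  Nothing of the series is asserted; no side taken on [IUTchIII] Cor 3.12.
-/

noncomputable section

namespace Literature.IUT.HodgeArakelov

open Literature.AnabelianGeometry.EtaleTheta Literature.AnabelianGeometry.SemiGraphs Literature.IUT.HodgeTheaters
open scoped Pointwise

namespace PlusMinusTower

section Genuine

variable {p : ℕ} [Fact p.Prime] {M : MuTwoSetting p}
  {E : M.toThetaSetting.EtaleThetaData} {l : ℕ} (C : E.DoubleUnderline l) {N : ℕ+}
  (μ : M.toThetaSetting.CyclotomeMod l N) (hC : M.toThetaSetting.Compat) (hS : M.toThetaSetting.Sec2Hyps)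
  (hl : l.Prime) (hp2 : p ≠ 2) (hpl : p ≠ l) (hζ : ∃ ζ : M.toThetaSetting.K, IsPrimitiveRoot ζ (4 * l))
  {η : (C.thetaEnvData μ hC hS).PiYdd → MuN p N} (hη : η ∈ (C.thetaEnvData μ hC hS).thetaCocycles)
  {P : TopGroup.{0}} {T : TemperedCoverings (BadPlaceSetting.ofUnderline C μ hC hS hl hp2 hpl hζ hη) P}
  (d : M.toTemperedCurve.GroupLevelData)
  (Sfu : SpecialFibreData ((M.toThetaSetting.temperedCurveXuOfLevelData l C.l_ne_zero d).toTemperedArithmeticGroup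
    (M.toThetaSetting.groupLevelDataXu l C.l_ne_zero d)))
  (h36u : Sfu.Gc.Prop36Hypotheses) (Sigmau SigmaHatu : Set ℕ) (hsubu : Sigmau ⊆ SigmaHatu) (hneu : Sigmau.Nonempty)
  (hprimeu : ∀ q ∈ SigmaHatu, q.Prime) (hpu : p ∉ Sigmau) (TpHu : Subgroup Sfu.chart.G)
  (HatHu : Subgroup (TemperedGraphGroupData.exists_completion_of_prop36 Sfu.Gc h36u Sfu.chart).choose)
  (hleu : TpHu.map (TemperedGraphGroupData.exists_completion_of_prop36 Sfu.Gc h36u Sfu.chart).choose_spec.choose.toMonoidHom ≤ HatHu)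
  (cuspu : {x : (M.toThetaSetting.temperedCurveXuOfLevelData l C.l_ne_zero d).Pt //
    (M.toThetaSetting.temperedCurveXuOfLevelData l C.l_ne_zero d).IsCusp x} → Prop)
  -- the three [EtTh] cusp clauses of the base curve `X_v`
  (hC3 : ∀ x : M.toTemperedCurve.Pt, M.toTemperedCurve.IsCusp x →
    (M.toTemperedCurve.inertia x).map M.toThetaSetting.toTheta = M.toThetaSetting.DeltaTheta)
  (hproper : M.toThetaSetting.lDeltaTheta l ≠ M.toThetaSetting.DeltaTheta)

omit hC3 hproper in
/-- **`I_x ⊆ Π^tp_Y`** for every cusp `x` of the base curve `X_v` ([EtTh] §1 p. 13: «any decomposition group of a cusp of `Y^log` …»; here for the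
INERTIA group, from the interface alone): `I_x ≃ₜ* Ẑ` (abc-iut-L3's field `inertia_equiv_zHat`) is compact, and compact subgroups of `Π^tp_X` lie in
`Π^tp_Y = Ker(Π^tp_X ↠ Z)` (abc-iut-L6-d6's `ThetaSetting.le_GtpY_of_isCompact`, the discreteness of `Z`).  PROVED.
[cite: MochizukiEtTh2009, §1 p.13] [cite: MochizukiSemiAnbd2006, §6 p.71] -/
theorem _root_.Literature.AnabelianGeometry.EtaleTheta.ThetaSetting.inertia_le_GtpY
    (D : Literature.AnabelianGeometry.EtaleTheta.ThetaSetting p)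
    {x : D.Pt} (hx : D.IsCusp x) : D.toTemperedCurve.inertia x ≤ D.GtpY := by
  obtain ⟨e⟩ := D.inertia_equiv_zHat x hx
  haveI : CompactSpace ↥(D.decomp x ⊓ D.aug.toMonoidHom.ker) := e.toHomeomorph.symm.compactSpace
  exact D.le_GtpY_of_isCompact _ (isCompact_iff_compactSpace.mpr this)

/-- In a group, `a * b * a⁻¹ = 1 ↔ b = 1`. [folklore] -/
private theorem mul_mul_inv_eq_one_iff {G : Type*} [Group G] (a b : G) : a * b * a⁻¹ = 1 ↔ b = 1 := by
  constructor
  · intro h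
    calc b = a⁻¹ * (a * b * a⁻¹) * a := by group
      _ = 1 := by rw [h]; group
  · rintro rfl; group

include hC3 hproper in
/-- **TOTAL RAMIFICATION at the genuine agreement** ([IUTchII] Rmk 2.1.1 (i) p. 65 / Def 2.3 (iii) p. 68: «the inclusion `Π_⊆ ⊆ Π_⊇` corresponds to a
totally ramified covering»; [EtTh] Def 2.1 p. 35): for ANY tower `W` over a Prop 2.1 output of `BadPlaceSetting.ofUnderline`, ANY cusp datum `Cu`
with an agreement `A : StableCurveAgreement W Cu Du` (`Du` = the [IUTchI] §2 datum of `X̲_v`, clause `A.eHat ∘ emb = toHat ∘ plainIso`), NO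
`Π^±_v`-cuspidal inertia group lies in `Π_v` — granted the cusp clause (C3) `toTheta(I_x) = Δ_Θ` of the base curve and `l·Δ_Θ ≠ Δ_Θ`.
PROOF: such an `I` is `emb ∘ plainIso⁻¹` of `t·I_y·t⁻¹`, `I_y = Π^tp_{X̲_v} ∩ g D_x g⁻¹ ∩ Δ ⊇ g I_x g⁻¹` (`inertia_le_GtpY`); `I ≤ Π_v` would put
`(tg) I_x (tg)⁻¹` inside `Π^tp_{X̲̲_v}`, whence `Δ_Θ = toTheta((tg) I_x (tg)⁻¹) ≤ toTheta(Π^tp_{X̲̲_v}) ∩ Δ_Θ = l·Δ_Θ` (abc-iut-L2-t8's `map_toTheta_Huu`).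
([IUTchII] Rmk 2.3.1, kurims p.69) [cite: Mochizuki2012, II Rmk 2.1.1 (i) p.65] [claim: Mochizuki2012, status: disputed] -/
theorem StableCurveAgreement.not_le_piV_of_isCuspidalInertia_piPM (W : PlusMinusTower T) {Cu : CuspidalInertiaData W}
    (A : StableCurveAgreement W Cu
      (StableCurveTemperedData.ofSpecialFibre (M.toThetaSetting.temperedCurveXuOfLevelData l C.l_ne_zero d)
        (M.toThetaSetting.groupLevelDataXu l C.l_ne_zero d) Sfu h36u Sigmau SigmaHatu hsubu hneu hprimeu hpu TpHu HatHu hleu cuspu))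
    (hA : ∀ x : T.Xplain, A.eHat ⟨W.emb x, W.emb_le_pmHat ⟨x, rfl⟩⟩ =
      (StableCurveTemperedData.ofSpecialFibre (M.toThetaSetting.temperedCurveXuOfLevelData l C.l_ne_zero d)
        (M.toThetaSetting.groupLevelDataXu l C.l_ne_zero d) Sfu h36u Sigmau SigmaHatu hsubu hneu hprimeu hpu TpHu HatHu hleu cuspu).ιX
        (T.plainIso x))
    {I : Subgroup W.Corhat} (hI : Cu.IsCuspidalInertia W.piPM I) : ¬ I ≤ W.piV := by
  intro hIV
  let X : TemperedCurve p := M.toTemperedCurve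
  obtain ⟨-, xu, t, hEq⟩ := (A.inertia_iff I).mp hI
  -- the cusp `x := xu.1.1` of `X_v`, the representative `g`, and `k i := (t g) i (t g)⁻¹`
  have hx : X.IsCusp xu.1.1 := xu.2
  set g : M.PiTemp := X.repOfOpen (M.GtpXu l) xu.1 with hg
  -- STEP 1: every `(t g) i (t g)⁻¹`, `i ∈ I_x`, lies in `Π^tp_{X̲̲_v}`
  have hstep : ∀ i ∈ X.inertia xu.1.1, t.1 * g * i * (t.1 * g)⁻¹ ∈ C.Huu := by
    intro i hi
    have hiD : i ∈ X.decomp xu.1.1 := (Subgroup.mem_inf.mp hi).1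
    have hiΔ : X.aug i = 1 := (Subgroup.mem_inf.mp hi).2
    have hiZ : M.toThetaSetting.toZ i = 1 := M.toThetaSetting.inertia_le_GtpY hx hi
    -- `k := (tg) i (tg)⁻¹ ∈ Π^tp_{X̲_v}` (its `toZ` is trivial: `ℤ` is commutative)
    have hkZ : M.toThetaSetting.toZ (t.1 * g * i * (t.1 * g)⁻¹) = 1 := by
      rw [map_mul, map_inv, map_mul, hiZ, mul_one, mul_inv_cancel]
    have hkXu : t.1 * g * i * (t.1 * g)⁻¹ ∈ M.GtpXu l :=
      M.toThetaSetting.GtpY_le_GtpXu l hkZ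
    -- `⟨k, _⟩` lies in `t · I_y · t⁻¹`
    have e1 : g⁻¹ * (t.1⁻¹ * (t.1 * g * i * (t.1 * g)⁻¹) * t.1) * g⁻¹⁻¹ = i := by
      group
    have hkK := (mem_conj_inertiaTp_ofSpecialFibre_iff (M.toThetaSetting.temperedCurveXuOfLevelData l C.l_ne_zero d)
      (M.toThetaSetting.groupLevelDataXu l C.l_ne_zero d) Sfu h36u Sigmau SigmaHatu hsubu hneu hprimeu hpu TpHu HatHu hleu cuspu
      xu t ⟨_, hkXu⟩).mpr ⟨by
        -- `t⁻¹ k t = g i g⁻¹` lies in `D_y = Π^tp_{X̲_v} ∩ g D_x g⁻¹`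
        change g⁻¹ * (t.1⁻¹ * (t.1 * g * i * (t.1 * g)⁻¹) * t.1) * g⁻¹⁻¹ ∈ X.decomp xu.1.1
        rw [e1]
        exact hiD, by
        change X.aug (t.1 * g * i * (t.1 * g)⁻¹) = 1
        rw [map_mul, map_inv, map_mul, hiΔ, mul_one, mul_inv_cancel]⟩
    -- hence `emb (plainIso⁻¹ k) ∈ I ≤ Π_v`, so `plainIso⁻¹ k = incl z`, so `k = refIso z ∈ Π^tp_{X̲̲_v}`
    have hmem := (A.emb_mem_iff_of_map_eq (fun x => T.plainIso x) hA hEq (T.plainIso.symm ⟨_, hkXu⟩)).mpr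
      (by simpa using hkK)
    obtain ⟨z, hz⟩ := hIV hmem
    have hz' : T.incl z = T.plainIso.symm ⟨_, hkXu⟩ := W.emb_injective hz
    have hk : ((T.plainIso (T.incl z)).1 : M.PiTemp) = t.1 * g * i * (t.1 * g)⁻¹ := by
      rw [hz', ContinuousMulEquiv.apply_symm_apply]
    rw [← hk, T.plainIso_incl]
    exact (T.refIso z).2
  -- STEP 2: `Δ_Θ ≤ toTheta(Π^tp_{X̲̲_v}) ∩ Δ_Θ = l·Δ_Θ`
  have hΔ : M.toThetaSetting.DeltaTheta ≤ M.toThetaSetting.lDeltaTheta l := by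
    intro δ hδ
    rw [← C.map_toTheta_Huu]
    refine Subgroup.mem_inf.mpr ⟨?_, hδ⟩
    -- conjugate `δ` back by `toTheta (t g)`: it lies in `Δ_Θ = toTheta(I_x)`
    have hδ' : (M.toThetaSetting.toTheta (t.1 * g))⁻¹ * δ * M.toThetaSetting.toTheta (t.1 * g) ∈
        (X.inertia xu.1.1).map M.toThetaSetting.toTheta := by
      rw [hC3 xu.1.1 hx]
      have := (inferInstanceAs M.toThetaSetting.thetaToEll.ker.Normal : M.toThetaSetting.DeltaTheta.Normal).conj_mem δ hδ
        (M.toThetaSetting.toTheta (t.1 * g))⁻¹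
      simpa using this
    obtain ⟨i, hi, hiδ⟩ := hδ'
    refine ⟨t.1 * g * i * (t.1 * g)⁻¹, hstep i hi, ?_⟩
    rw [map_mul, map_inv, map_mul, hiδ]
    group
  exact hproper (le_antisymm (M.toThetaSetting.lDeltaTheta_le l) hΔ)

include hC3 hproper in
/-- **[IUTchII] Rmk 2.3.1, first claim, AS A THEOREM at a genuine agreement**: `Rmk231_powers Cu Π_v Π^±_v` (abc-iut-L6-t1's named Prop, p407174:
«`I ∩ Π_v = I^l`» for every `Π^±_v`-cuspidal `I`), for ANY tower `W` over a Prop 2.1 output of `BadPlaceSetting.ofUnderline` with `Π̂^cor_v` Hausdorff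
and `emb` continuous, ANY cusp datum `Cu` with an agreement `A` with the [IUTchI] §2 datum of `X̲_v` (clause `A.eHat ∘ emb = toHat ∘ plainIso`).
The printed inputs of abc-iut-L6-t19's `rmk231_powers_of_zHat` (p418082) are supplied BY NAME: `Π_v ⊴ Π^±_v` (p429966, from hN), `[Π^±_v : Π_v] = l`
(p429377), `I ≃ₜ* Ẑ` (p443151), total ramification (`not_le_piV_of_isCuspidalInertia_piPM`, from (C3) and `l·Δ_Θ ≠ Δ_Θ`).  PROVED.
([IUTchII] Rmk 2.3.1, kurims p.69) [cite: Mochizuki2012, II Rmk 2.3.1 p.69] [claim: Mochizuki2012, status: disputed] -/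
theorem StableCurveAgreement.rmk231_powers_genuine (hN : (C.Huu.subgroupOf (M.GtpXu l)).Normal) (W : PlusMinusTower T)
    [T2Space W.Corhat] (hemb : Continuous W.emb) {Cu : CuspidalInertiaData W}
    (A : StableCurveAgreement W Cu
      (StableCurveTemperedData.ofSpecialFibre (M.toThetaSetting.temperedCurveXuOfLevelData l C.l_ne_zero d)
        (M.toThetaSetting.groupLevelDataXu l C.l_ne_zero d) Sfu h36u Sigmau SigmaHatu hsubu hneu hprimeu hpu TpHu HatHu hleu cuspu))
    (hA : ∀ x : T.Xplain, A.eHat ⟨W.emb x, W.emb_le_pmHat ⟨x, rfl⟩⟩ =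
      (StableCurveTemperedData.ofSpecialFibre (M.toThetaSetting.temperedCurveXuOfLevelData l C.l_ne_zero d)
        (M.toThetaSetting.groupLevelDataXu l C.l_ne_zero d) Sfu h36u Sigmau SigmaHatu hsubu hneu hprimeu hpu TpHu HatHu hleu cuspu).ιX
        (T.plainIso x)) :
    Literature.IUT.HodgeArakelov.Rmk231_powers Cu W.piV W.piPM :=
  rmk231_powers_of_zHat Cu W.piV_le_piPM
    (W.piV_subgroupOf_piPM_normal_ofUnderline C μ hC hS hl hp2 hpl hζ hη hN)
    (W.index_piV_subgroupOf_piPM_ofUnderline_eq_l C μ hC hS hl hp2 hpl hζ hη)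
    (fun _ hI => StableCurveAgreement.nonempty_equiv_zHat_of_isCuspidalInertia_piPM
      (M.toThetaSetting.temperedCurveXuOfLevelData l C.l_ne_zero d) (M.toThetaSetting.groupLevelDataXu l C.l_ne_zero d)
      Sfu h36u Sigmau SigmaHatu hsubu hneu hprimeu hpu TpHu HatHu hleu cuspu hemb A T.plainIso hA hI)
    (fun _ hI => StableCurveAgreement.not_le_piV_of_isCuspidalInertia_piPM C μ hC hS hl hp2 hpl hζ hη d Sfu h36u Sigmau SigmaHatu
      hsubu hneu hprimeu hpu TpHu HatHu hleu cuspu hC3 hproper W A hA hI)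

end Genuine

/-! ## The instance at the tower of record -/

section Record

variable {p : ℕ} [Fact p.Prime] {M : MuTwoSetting p} (e : M.CLevelData)
  {E : M.toThetaSetting.EtaleThetaData} {l : ℕ} (C : E.DoubleUnderline l) {N : ℕ+}
  (μ : M.toThetaSetting.CyclotomeMod l N) (hC : M.toThetaSetting.Compat) (hS : M.toThetaSetting.Sec2Hyps)
  (hl : l.Prime) (hp2 : p ≠ 2) (hpl : p ≠ l) (hζ : ∃ ζ : M.toThetaSetting.K, IsPrimitiveRoot ζ (4 * l))
  {η : (C.thetaEnvData μ hC hS).PiYdd → MuN p N} (hη : η ∈ (C.thetaEnvData μ hC hS).thetaCocycles)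
  (hZ : Thm16Sub.KerToZIsCompactlyGenerated M.toThetaSetting) (hN : (C.Huu.subgroupOf (M.GtpXu l)).Normal)
  {P : TopGroup.{0}} (T : TemperedCoverings (BadPlaceSetting.ofUnderline C μ hC hS hl hp2 hpl hζ hη) P)
  (d : M.toTemperedCurve.GroupLevelData)
  (Sfu : SpecialFibreData ((M.toThetaSetting.temperedCurveXuOfLevelData l C.l_ne_zero d).toTemperedArithmeticGroup
    (M.toThetaSetting.groupLevelDataXu l C.l_ne_zero d)))
  (h36u : Sfu.Gc.Prop36Hypotheses) (Sigmau SigmaHatu : Set ℕ) (hsubu : Sigmau ⊆ SigmaHatu) (hneu : Sigmau.Nonempty)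
  (hprimeu : ∀ q ∈ SigmaHatu, q.Prime) (hpu : p ∉ Sigmau) (TpHu : Subgroup Sfu.chart.G)
  (HatHu : Subgroup (TemperedGraphGroupData.exists_completion_of_prop36 Sfu.Gc h36u Sfu.chart).choose)
  (hleu : TpHu.map (TemperedGraphGroupData.exists_completion_of_prop36 Sfu.Gc h36u Sfu.chart).choose_spec.choose.toMonoidHom ≤ HatHu)
  (cuspu : {x : (M.toThetaSetting.temperedCurveXuOfLevelData l C.l_ne_zero d).Pt //
    (M.toThetaSetting.temperedCurveXuOfLevelData l C.l_ne_zero d).IsCusp x} → Prop)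
  (hC3 : ∀ x : M.toTemperedCurve.Pt, M.toTemperedCurve.IsCusp x →
    (M.toTemperedCurve.inertia x).map M.toThetaSetting.toTheta = M.toThetaSetting.DeltaTheta)
  (hproper : M.toThetaSetting.lDeltaTheta l ≠ M.toThetaSetting.DeltaTheta)

/-- `emb` of the tower of record is continuous (it is `embHat` of p431233 followed by the inclusion `Π̂^±_v ⊆ Π_C`).
([IUTchII] Def 2.3 (i), kurims p.67) [claim: Mochizuki2012, status: disputed] -/
theorem continuous_emb_ofPiCHat : Continuous (ofPiCHat e C μ hC hS hl hp2 hpl hζ hη hZ hN T).emb := by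
  obtain ⟨embHat, hembHat, -⟩ := exists_embHat_ofPiCHat e C μ hC hS hl hp2 hpl hζ hη hZ hN T
  have h : ((ofPiCHat e C μ hC hS hl hp2 hpl hζ hη hZ hN T).emb : T.Xplain → (ofPiCHat e C μ hC hS hl hp2 hpl hζ hη hZ hN T).Corhat) =
      fun x => ((embHat x : (ofPiCHat e C μ hC hS hl hp2 hpl hζ hη hZ hN T).pmHat) :
        (ofPiCHat e C μ hC hS hl hp2 hpl hζ hη hZ hN T).Corhat) :=
    funext fun x => (hembHat x).symm
  rw [h]
  exact continuous_subtype_val.comp embHat.continuous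

include hC3 hproper in
/-- **[IUTchII] Rmk 2.3.1 «`I ∩ Π_v = I^l`» AT THE TOWER OF RECORD `ofPiCHat`, for the cusp datum of record** (abc-iut-w5-d132's agreement
p434636, packaged): `∃ Cu A`, with the p434636 clauses, such that `Rmk231_powers Cu Π_v Π^±_v` — granted only the [EtTh] cusp clause (C3)
`toTheta(I_x) = Δ_Θ` of the base curve, `l·Δ_Θ ≠ Δ_Θ`, and the tower's own inputs L02 `hZ`, `hN` (special-fibre DATA of `X̲_v` quantified).  PROVED.
([IUTchII] Rmk 2.3.1, kurims p.69) [cite: Mochizuki2012, II Rmk 2.3.1 p.69] [claim: Mochizuki2012, status: disputed] -/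
theorem rmk231_powers_ofPiCHat :
    ∃ (Cu : CuspidalInertiaData (ofPiCHat e C μ hC hS hl hp2 hpl hζ hη hZ hN T))
      (A : StableCurveAgreement (ofPiCHat e C μ hC hS hl hp2 hpl hζ hη hZ hN T) Cu
        (StableCurveTemperedData.ofSpecialFibre (M.toThetaSetting.temperedCurveXuOfLevelData l C.l_ne_zero d)
          (M.toThetaSetting.groupLevelDataXu l C.l_ne_zero d) Sfu h36u Sigmau SigmaHatu hsubu hneu hprimeu hpu TpHu HatHu hleu cuspu)),
      (∀ x : T.Xplain,
        A.eHat ⟨(ofPiCHat e C μ hC hS hl hp2 hpl hζ hη hZ hN T).emb x,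
            (ofPiCHat e C μ hC hS hl hp2 hpl hζ hη hZ hN T).emb_le_pmHat ⟨x, rfl⟩⟩ =
          (StableCurveTemperedData.ofSpecialFibre (M.toThetaSetting.temperedCurveXuOfLevelData l C.l_ne_zero d)
            (M.toThetaSetting.groupLevelDataXu l C.l_ne_zero d) Sfu h36u Sigmau SigmaHatu hsubu hneu hprimeu hpu TpHu HatHu hleu
            cuspu).ιX (T.plainIso x)) ∧
      (∀ (Q I : Subgroup (ofPiCHat e C μ hC hS hl hp2 hpl hζ hη hZ hN T).Corhat), Cu.IsCuspidalInertia Q I ↔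
        I ≤ Q ∧ ∃ I₀, Cu.IsCuspidalInertia (ofPiCHat e C μ hC hS hl hp2 hpl hζ hη hZ hN T).piPM I₀ ∧ I = I₀ ⊓ Q) ∧
      Literature.IUT.HodgeArakelov.Rmk231_powers Cu (ofPiCHat e C μ hC hS hl hp2 hpl hζ hη hZ hN T).piV
        (ofPiCHat e C μ hC hS hl hp2 hpl hζ hη hZ hN T).piPM := by
  haveI : T2Space (ofPiCHat e C μ hC hS hl hp2 hpl hζ hη hZ hN T).Corhat := e.isProfiniteCompletion_toPiCHat.t2Space
  obtain ⟨Cu, A, hA, hlev⟩ := exists_stableCurveAgreement_ofPiCHat_ofSpecialFibreXu e C μ hC hS hl hp2 hpl hζ hη hZ hN T d Sfu h36u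
    Sigmau SigmaHatu hsubu hneu hprimeu hpu TpHu HatHu hleu cuspu
  exact ⟨Cu, A, hA, hlev, StableCurveAgreement.rmk231_powers_genuine C μ hC hS hl hp2 hpl hζ hη d Sfu h36u Sigmau SigmaHatu hsubu hneu
    hprimeu hpu TpHu HatHu hleu cuspu hC3 hproper hN (ofPiCHat e C μ hC hS hl hp2 hpl hζ hη hZ hN T)
    (continuous_emb_ofPiCHat e C μ hC hS hl hp2 hpl hζ hη hZ hN T) A hA⟩

end Record

end PlusMinusTower

end Literature.IUT.HodgeArakelov

end
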